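import Literature.Computability.Complexity.ArthurMerlinGamesProofs
import HarnessLib

/-!
# `AM(1) = BPP` and `MA(1) = NP` (Babai–Moran 1988, §1.3) — proofs

Sibling proof file of `ArthurMerlinGames.lean` (D-0014), discharging the named facts
`Literature.Computability.Complexity.AMk_one_eq_BPP` and `Literature.Computability.Complexity.MAk_one_eq_NP`
("It should be clear that `MA(1) = NP` and `AM(1) = BPP`", Babai–Moran, JCSS 36 (1988), §1.3) for
the tree's game classes, with the one-move game values of `ArthurMerlinGamesProofs.lean`
(`amValue_arthur_eq`: Arthur's single random move is judged with probability
`Pr_y[⟨x, enc (y)⟩ ∈ Ref]`; `amValue_merlin_eq_one/zero`: Merlin's single move is worth `1` iff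
some move wins) and the same re-encoding / padding bricks (`pairFn`, `fstP`, `sndP`, `LenEq`,
`AMTwo.pad`):

* `AM(1) ⊆ BPP`: `L' = {⟨x, y⟩ | ⟨x, enc (y)⟩ ∈ Ref} ∈ P`, coins `m`; `BPP ⊆ AM(1)`:
  `Ref = {⟨x, enc (y)⟩ | ⟨x, y⟩ ∈ L'}`, moves of the coin length;
* `MA(1) ⊆ NP`: verifier `{⟨x, y⟩ | |y| = m(|x|) ∧ ⟨x, enc (y)⟩ ∈ Ref} ∈ P`, bound `m`;
  `NP ⊆ MA(1)`: moves of length `2q(n) + 2` read as padded witnesses `⟨z', 0…0⟩`, referee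
  "`|z'| ≤ q(|x|)` and the verifier accepts `⟨x, z'⟩`".

## References

* L. Babai, S. Moran, *Arthur–Merlin games: a randomized proof system, and a hierarchy of
  complexity classes*, JCSS 36 (1988), §1.3.
* S. Arora, B. Barak, *Computational Complexity: A Modern Approach*, CUP 2009, Def. 7.3 (`BPP`
  with random strings), Def. 2.1 (`NP`), Def. 8.10.
-/

noncomputable section

namespace Literature.Computability.Complexity

open _root_.Computability Finset Polynomial AMPlayer

namespace AMOne

/-- `⟨x, y⟩ ↦ ⟨x, enc (y)⟩`. [folklore] -/
def encOneFn : List Bool → List Bool :=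
  pairFn fstP (pairFn (fun _ => [true]) (pairFn id fun _ => []) ∘ sndP)

/-- `encOneFn ⟨x, y⟩ = ⟨x, enc (y)⟩`. [folklore] -/
theorem encOneFn_apply (x y : List Bool) : encOneFn (boolPair x y) = boolPair x (encMoves [y]) := by
  simp [encOneFn, encMoves_one, Function.comp_apply]

/-- `encOneFn ∈ FP`. [folklore] -/
theorem encOneFn_mem_FP : encOneFn ∈ FP :=
  pairFn_mem_FP fstP_mem_FP (comp_mem_FP
    (pairFn_mem_FP (const_mem_FP _) (pairFn_mem_FP (PolyTimeComputable.id _) (const_mem_FP _)))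
    sndP_mem_FP)

/-- `⟨x, enc (y)⟩ ↦ ⟨x, y⟩` (inverse re-encoding on referee inputs). [folklore] -/
def ofRefFn : List Bool → List Bool :=
  pairFn fstP (fstP ∘ sndP ∘ sndP)

/-- `ofRefFn ⟨x, enc (y)⟩ = ⟨x, y⟩`. [folklore] -/
theorem ofRefFn_apply (x y : List Bool) : ofRefFn (boolPair x (encMoves [y])) = boolPair x y := by
  simp [ofRefFn, encMoves_one, Function.comp_apply]

/-- `ofRefFn ∈ FP`. [folklore] -/
theorem ofRefFn_mem_FP : ofRefFn ∈ FP :=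
  pairFn_mem_FP fstP_mem_FP (comp_mem_FP fstP_mem_FP (comp_mem_FP sndP_mem_FP sndP_mem_FP))

/-- `⟨x, enc (z)⟩ ↦ ⟨x, fst z⟩` (unpad Merlin's move). [folklore] -/
def unpadFn : List Bool → List Bool :=
  pairFn fstP (fstP ∘ fstP ∘ sndP ∘ sndP)

/-- `unpadFn ⟨x, enc (z)⟩ = ⟨x, fst z⟩`. [folklore] -/
theorem unpadFn_apply (x z : List Bool) :
    unpadFn (boolPair x (encMoves [z])) = boolPair x (fstP z) := by
  simp [unpadFn, encMoves_one, Function.comp_apply]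

/-- `unpadFn ∈ FP`. [folklore] -/
theorem unpadFn_mem_FP : unpadFn ∈ FP :=
  pairFn_mem_FP fstP_mem_FP
    (comp_mem_FP fstP_mem_FP (comp_mem_FP fstP_mem_FP (comp_mem_FP sndP_mem_FP sndP_mem_FP)))

/-- The `P` language of `AM(1) ⊆ BPP`: `⟨x, y⟩` such that the referee accepts `⟨x, enc (y)⟩`.
[cite: BabaiMoran1988, §1.3] -/
def bppLang (Ref : Language Bool) : Language Bool := {w | encOneFn w ∈ Ref}

/-- Membership of a pair in `bppLang`. [folklore] -/
theorem boolPair_mem_bppLang (Ref : Language Bool) (x y : List Bool) :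
    boolPair x y ∈ bppLang Ref ↔ boolPair x (encMoves [y]) ∈ Ref := by
  change encOneFn (boolPair x y) ∈ Ref ↔ _
  rw [encOneFn_apply]

/-- `bppLang Ref ∈ P`. [folklore] -/
theorem bppLang_mem_P {Ref : Language Bool} (hRef : Ref ∈ Classes.P) : bppLang Ref ∈ Classes.P := by
  have h := preimage_mem_P hRef encOneFn_mem_FP
  exact h

/-- The referee of `BPP ⊆ AM(1)`: accept `⟨x, enc (y)⟩` iff `⟨x, y⟩ ∈ L'`. [cite: BabaiMoran1988, §1.3] -/
def bppRef (L' : Language Bool) : Language Bool := {w | ofRefFn w ∈ L'}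

/-- Membership in `bppRef`. [folklore] -/
theorem mem_bppRef_iff (L' : Language Bool) (x y : List Bool) :
    boolPair x (encMoves [y]) ∈ bppRef L' ↔ boolPair x y ∈ L' := by
  change ofRefFn (boolPair x (encMoves [y])) ∈ L' ↔ _
  rw [ofRefFn_apply]

/-- `bppRef L' ∈ P`. [folklore] -/
theorem bppRef_mem_P {L' : Language Bool} (hL' : L' ∈ Classes.P) : bppRef L' ∈ Classes.P := by
  have h := preimage_mem_P hL' ofRefFn_mem_FP
  exact h

/-- The `P` verifier of `MA(1) ⊆ NP`: `⟨x, y⟩` with `|y| = m(|x|)` and `⟨x, enc (y)⟩ ∈ Ref`.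
[cite: BabaiMoran1988, §1.3] -/
def npVerif (Ref : Language Bool) (m : Polynomial ℕ) : Language Bool :=
  {w | w ∈ LenEq m ∧ encOneFn w ∈ Ref}

/-- Membership of a pair in `npVerif`. [folklore] -/
theorem boolPair_mem_npVerif (Ref : Language Bool) (m : Polynomial ℕ) (x y : List Bool) :
    boolPair x y ∈ npVerif Ref m ↔ y.length = m.eval x.length ∧ boolPair x (encMoves [y]) ∈ Ref := by
  change boolPair x y ∈ LenEq m ∧ encOneFn (boolPair x y) ∈ Ref ↔ _
  rw [boolPair_mem_LenEq, encOneFn_apply]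

/-- `npVerif Ref m ∈ P`. [folklore] -/
theorem npVerif_mem_P {Ref : Language Bool} (hRef : Ref ∈ Classes.P) (m : Polynomial ℕ) :
    npVerif Ref m ∈ Classes.P := by
  have h := inter_mem_P (LenEq_mem_P m) (preimage_mem_P hRef encOneFn_mem_FP)
  exact h

/-- The referee of `NP ⊆ MA(1)`: accept `⟨x, enc (z)⟩` iff `|fst z| ≤ q(|x|)` and `⟨x, fst z⟩ ∈ L''`.
[cite: BabaiMoran1988, §1.3] -/
def maRef (L'' : Language Bool) (q : Polynomial ℕ) : Language Bool :=
  {w | unpadFn w ∈ LenLe q ∧ unpadFn w ∈ L''}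

/-- Membership in `maRef`. [folklore] -/
theorem mem_maRef_iff (L'' : Language Bool) (q : Polynomial ℕ) (x z : List Bool) :
    boolPair x (encMoves [z]) ∈ maRef L'' q ↔
      (fstP z).length ≤ q.eval x.length ∧ boolPair x (fstP z) ∈ L'' := by
  change unpadFn (boolPair x (encMoves [z])) ∈ LenLe q ∧ unpadFn (boolPair x (encMoves [z])) ∈ L'' ↔ _
  rw [unpadFn_apply, boolPair_mem_LenLe]

/-- `maRef L'' q ∈ P`. [folklore] -/
theorem maRef_mem_P {L'' : Language Bool} (hL'' : L'' ∈ Classes.P) (q : Polynomial ℕ) :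
    maRef L'' q ∈ Classes.P := by
  have h := preimage_mem_P (inter_mem_P (LenLe_mem_P q) hL'') unpadFn_mem_FP
  exact h

end AMOne

/-! ### `AM(1) = BPP` -/

/-- **`AM(1) ⊆ BPP`.** [cite: BabaiMoran1988, §1.3] -/
theorem AMk_one_subset_BPP : AMk 1 ⊆ BPP := by
  rintro L ⟨Ref, hRef, m, hL⟩
  refine ⟨AMOne.bppLang Ref, AMOne.bppLang_mem_P hRef, m, fun x => ?_⟩
  have hpat : (arthur.alternate 1) = [arthur] := rfl
  obtain ⟨h1, h2⟩ := hL x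
  simp only [hpat] at h1 h2
  rw [amValue_arthur_eq] at h1 h2
  by_cases hx : x ∈ L
  · refine (h1 hx).trans_eq (uniformProb_congr fun y _ => ?_)
    simp only [Set.mem_setOf_eq, hx, iff_true]
    exact (AMOne.boolPair_mem_bppLang Ref x y).symm
  · have hc := uniformProb_compl (m.eval x.length) {y | boolPair x (encMoves [y]) ∈ Ref}
    have hset : uniformProb (m.eval x.length) {y | boolPair x y ∈ AMOne.bppLang Ref ↔ x ∈ L} =
        uniformProb (m.eval x.length) {y | boolPair x (encMoves [y]) ∈ Ref}ᶜ :=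
      uniformProb_congr fun y _ => by
        simp only [Set.mem_setOf_eq, hx, iff_false, Set.mem_compl_iff]
        exact not_congr (AMOne.boolPair_mem_bppLang Ref x y)
    rw [hset, hc]
    have h := h2 hx
    linarith

/-- **`BPP ⊆ AM(1)`.** [cite: BabaiMoran1988, §1.3] -/
theorem BPP_subset_AMk_one : BPP ⊆ AMk 1 := by
  rintro L ⟨L', hL', p, hp⟩
  refine ⟨AMOne.bppRef L', AMOne.bppRef_mem_P hL', p, fun x => ?_⟩
  have hpat : (arthur.alternate 1) = [arthur] := rfl
  simp only [hpat]
  rw [amValue_arthur_eq]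
  have hev : uniformProb (p.eval x.length) {y | boolPair x (encMoves [y]) ∈ AMOne.bppRef L'} =
      uniformProb (p.eval x.length) {y | boolPair x y ∈ L'} :=
    uniformProb_congr fun y _ => by
      simp only [Set.mem_setOf_eq]
      exact AMOne.mem_bppRef_iff L' x y
  rw [hev]
  have hgap := hp x
  constructor
  · intro hx
    refine hgap.trans_eq (congrArg _ (Set.ext fun y => ?_))
    simp only [Set.mem_setOf_eq, hx, iff_true]
  · intro hx
    have hset : {y : List Bool | boolPair x y ∈ L' ↔ x ∈ L} = {y | boolPair x y ∈ L'}ᶜ :=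
      Set.ext fun y => by simp only [Set.mem_setOf_eq, hx, iff_false, Set.mem_compl_iff]
    rw [hset, uniformProb_compl] at hgap
    linarith

/-- **Discharge of `AMk_one_eq_BPP`: `AM(1) = BPP`.** [cite: BabaiMoran1988, §1.3] -/
theorem AMk_one_eq_BPP_holds : AMk_one_eq_BPP :=
  Set.Subset.antisymm AMk_one_subset_BPP BPP_subset_AMk_one

/-! ### `MA(1) = NP` -/

/-- **`MA(1) ⊆ NP`**: a winning move of the exact length is a certificate.
[cite: BabaiMoran1988, §1.3] -/
theorem MAk_one_subset_NP : MAk 1 ⊆ Nondeterministic.NP := by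
  rintro L ⟨Ref, hRef, m, hL⟩
  refine ⟨AMOne.npVerif Ref m, AMOne.npVerif_mem_P hRef m, m, fun x => ?_⟩
  have hpat : (merlin.alternate 1) = [merlin] := rfl
  obtain ⟨h1, h2⟩ := hL x
  simp only [hpat] at h1 h2
  constructor
  · intro hx
    by_contra hne
    push Not at hne
    have hzero : amValue Ref (m.eval x.length) [merlin] x = 0 :=
      amValue_merlin_eq_zero fun ⟨y, hy⟩ =>
        hne y.toList (le_of_eq y.toList_length)
          ((AMOne.boolPair_mem_npVerif Ref m x _).2 ⟨y.toList_length, hy⟩)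
    have h := h1 hx
    rw [hzero] at h
    norm_num at h
  · rintro ⟨y, -, hy⟩
    rw [AMOne.boolPair_mem_npVerif] at hy
    by_contra hx
    have hone : amValue Ref (m.eval x.length) [merlin] x = 1 :=
      amValue_merlin_eq_one ⟨⟨y, hy.1⟩, hy.2⟩
    have h := h2 hx
    rw [hone] at h
    norm_num at h

/-- **`NP ⊆ MA(1)`**: Merlin's move of length `2q(n) + 2` carries the padded witness.
[cite: BabaiMoran1988, §1.3] -/
theorem NP_subset_MAk_one : Nondeterministic.NP ⊆ MAk 1 := by
  rintro L ⟨L'', hL'', q, hq⟩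
  refine ⟨AMOne.maRef L'' q, AMOne.maRef_mem_P hL'' q, 2 * q + 2, fun x => ?_⟩
  have hpat : (merlin.alternate 1) = [merlin] := rfl
  simp only [hpat]
  have hm : (2 * q + 2 : Polynomial ℕ).eval x.length = 2 * q.eval x.length + 2 := by simp
  constructor
  · intro hx
    obtain ⟨z', hlen, hz'⟩ := (hq x).1 hx
    have hfit : 2 * z'.length + 2 ≤ (2 * q + 2 : Polynomial ℕ).eval x.length := by rw [hm]; omega
    have hone : amValue (AMOne.maRef L'' q) ((2 * q + 2 : Polynomial ℕ).eval x.length) [merlin] x = 1 :=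
      amValue_merlin_eq_one ⟨⟨AMTwo.pad _ z', AMTwo.length_pad hfit⟩,
        (AMOne.mem_maRef_iff L'' q x _).2
          (by simp only [List.Vector.toList_mk, AMTwo.fstP_pad]; exact ⟨hlen, hz'⟩)⟩
    rw [hone]
    norm_num
  · intro hx
    have hzero : amValue (AMOne.maRef L'' q) ((2 * q + 2 : Polynomial ℕ).eval x.length) [merlin] x = 0 :=
      amValue_merlin_eq_zero fun ⟨z, hz⟩ =>
        hx ((hq x).2 ⟨fstP z.toList, (AMOne.mem_maRef_iff L'' q x _).1 hz⟩)
    rw [hzero]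
    norm_num

/-- **Discharge of `MAk_one_eq_NP`: `MA(1) = NP`.** [cite: BabaiMoran1988, §1.3] -/
theorem MAk_one_eq_NP_holds : MAk_one_eq_NP :=
  Set.Subset.antisymm MAk_one_subset_NP NP_subset_MAk_one

end Literature.Computability.Complexity

end
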